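import Literature.NumberTheory.EllipticCurves.LocalTatePairingRestriction
import Literature.NumberTheory.EllipticCurves.LocalPointsBaseChangeTower
import Literature.NumberTheory.PAdicHodge.DualExpEllipticRestriction
import Literature.NumberTheory.EllipticCurves.PadicLogFiniteExtensionLocalFieldProofs
import HarnessLib

/-!
# Kato's reciprocity law DESCENDS along a finite extension: the formula over `F` at restricted classes gives the formula over `F₀`

Topic `NumberTheory/EllipticCurves`; namespace `Literature.NumberTheory.EllipticCurves`. THEOREMS ONLY (no definition, no named fact, no
instance, no `sorry`). Brick D6 of memo `Summits/BirchSwinnertonDyer/BirchSwinnertonDyer/Cruxes/StarredOptimalManinUnitFiveSeven/Lines/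
kato-lever-K3-legendre.md` §7.2 gap 2 (crux K★ `stmt-BirchSwinnertonDyer-22226`): the kernel theorems of the `kato_lever` line give Kato's
formula `⟨[η], P⟩ = Tr_{F/ℚ_p}(c · exp*_d(η) · log_ω P)` over the RAMIFIED completion `F = K_v` where the good model lives, while the K★ closer
needs it over `F₀ = ℚ_p`. For a tower `K₀ ⊆ F₀ ⊆ F` of `p`-adic fields (`F/F₀` finite) and an elliptic curve `W/K₀`:

* ★★ `tatePairingPoint_eq_trace_of_res` — if Kato's formula holds over `F` for the DIRECT representation `T_pW|_{Γ_F}`, the line datum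
  `d.map V(τ)` (transport of a tower line datum `d` compatible with `d₀` under restriction — the clause of hT₂ / [REC-tower]) and a constant
  `c ∈ F`, at the restricted classes `Res η₀` (`Res = H¹(res_{F/F₀}; T(τ))`, `τ` the embedding element, `LocalTatePairingRestriction`) and
  the points of `E(F₀)`, then Kato's formula holds over `F₀` for EVERY `η₀ ∈ Z¹(Γ_{F₀}, T_pW)`, `P₀ ∈ E(F₀)`, with the constant
  `c₀ = [F:F₀]⁻¹ · Tr_{F/F₀}(c) ∈ F₀`:
  `⟨[η₀], P₀⟩_{F₀} = Tr_{F₀/ℚ_p}(c₀ · exp*_{d₀}(η₀) · log_ω P₀)`.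
  Ingredients: the degree formula `⟨Res x₀, P⟩_F = [F:F₀]·⟨x₀, P₀⟩_{F₀}` (`tatePairingPoint_res`, Serre XIII §3 Prop. 7), the point
  bookkeeping `LocalPointsBaseChangeTower`, `exp*_{d.map V(τ)}(Res η₀) = (F₀ → F)(exp*_{d₀} η₀)` (`DualExpEllipticRestriction`), the
  functoriality of `log_ω` in the field (hypothesis `hlog`; tree `padicLogPointFiniteExt_map_of_val_eq`), and `Tr_{F/ℚ_p} = Tr_{F₀/ℚ_p} ∘ Tr_{F/F₀}`.

No claim that `c₀ ≠ 0` (it follows from the non-degeneracy of the pairing where needed). BSD / K★ / [REC] are NOT proved by this file.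

## References
* K. Kato, LNM 1553 (1993), Ch. II §1.2.4 (functoriality in the field), Thm. 1.4.1. [Kato1993LNM1553]
* J.-P. Serre, *Local Fields* (1979), XIII §3 Prop. 7. [SerreLocalFields1979]
* J. Neukirch, A. Schmidt, K. Wingberg (2008), (7.1.4), (7.2.6). [NeukirchSchmidtWingberg2008]
-/

noncomputable section

open scoped Classical NNReal
open CategoryTheory Function Field ValuativeRel
open Literature.NumberTheory.GaloisRepresentations
open Literature.NumberTheory.GaloisRepresentations.IsNonarchimedeanLocalField
open Literature.NumberTheory.PAdicHodge

namespace Literature.NumberTheory.EllipticCurves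

open _root_.WeierstrassCurve

variable {K₀ : Type} [Field K₀] [CharZero K₀] (W : WeierstrassCurve K₀) [W.IsElliptic]
  -- the lower field
  (F₀ : Type) [Field F₀] [Algebra K₀ F₀] [ValuativeRel F₀] [TopologicalSpace F₀] [IsNonarchimedeanLocalField F₀] [CharZero F₀]
  {p : ℕ} [Fact p.Prime] [Fact (¬ IsUnit (p : integerC F₀))] [IsAdicComplete (Ideal.span {(p : integerC F₀)}) (integerC F₀)]
  (hp₀ : valuation F₀ p < 1) [Algebra ℚ_[p] F₀] [FiniteDimensional ℚ_[p] F₀]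
  (w₀ : Valuation F₀ ℝ≥0) [(W.baseChange F₀).IsIntegral w₀.integer]
  -- the upper field
  (F : Type) [Field F] [Algebra K₀ F] [Algebra F₀ F] [IsScalarTower K₀ F₀ F] [ValuativeRel F] [TopologicalSpace F]
  [IsNonarchimedeanLocalField F] [CharZero F] [Fact (¬ IsUnit (p : integerC F))]
  [IsAdicComplete (Ideal.span {(p : integerC F)}) (integerC F)]
  (hp : valuation F p < 1) [Algebra ℚ_[p] F] [IsScalarTower ℚ_[p] F₀ F] [FiniteDimensional F₀ F]
  (w : Valuation F ℝ≥0) [(W.baseChange F).IsIntegral w.integer]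
  -- the Weil tower
  (e : (k : ℕ) → geomTorsion W ((p ^ k : ℕ) : ℤ) → geomTorsion W ((p ^ k : ℕ) : ℤ) → AlgebraicClosure K₀)
  (hμ : ∀ k S T, e k S T ^ (p ^ k) = 1) (hadd₁ : ∀ k S₁ S₂ T, e k (S₁ + S₂) T = e k S₁ T * e k S₂ T)
  (hadd₂ : ∀ k S T₁ T₂, e k S (T₁ + T₂) = e k S T₁ * e k S T₂)
  (hgal : ∀ k (σ : absoluteGaloisGroup K₀) (S T : geomTorsion W ((p ^ k : ℕ) : ℤ)), σ • e k S T = e k (σ • S) (σ • T))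
  (hcompat : ∀ k (S T : geomTorsion W ((p ^ (k + 1) : ℕ) : ℤ)),
    e k (torsionMulHom W (p ^ (k + 1)) (p ^ k) p (pow_succ p k).symm S)
      (torsionMulHom W (p ^ (k + 1)) (p ^ k) p (pow_succ p k).symm T) = e (k + 1) S T ^ p)
  -- the embedding element of the tower and the intertwiner `V(τ)`
  {τ : absoluteGaloisGroup K₀}
  (hτ : ∀ x : AlgebraicClosure K₀, absClosureEmbedding F₀ F (absClosureEmbedding K₀ F₀ x) = absClosureEmbedding K₀ F (τ • x))
  (hconj : ∀ σ : absoluteGaloisGroup F,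
    absGaloisRestrict K₀ F σ = τ * ((absGaloisRestrict K₀ F₀).comp (absGaloisRestrict F₀ F)) σ * τ⁻¹)
  {gV : W.rationalTateModule p ≃ₗ[ℚ_[p]] W.rationalTateModule p}
  (hgVdef : ∀ m, gV m = (W.rationalTateGaloisRep p (W.continuous_rationalGaloisRepTate_holds p)) τ m)

include hgal hτ hgVdef in
/-- ★★ **Kato's reciprocity law descends along `F/F₀`.** Given: the Prop-1.2.3 binders of the tower representation, a tower line datum `d`
compatible with `d₀` under restriction (hT₂'s clause `hcomp`), the functoriality of `log_ω` for the points of `E(F₀)` read in `E(F)`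
(`hlog`), and Kato's formula over `F` (direct representation, line datum `d.map V(τ)`, constant `c`) at the restricted cocycles `Res η₀` and
the points `P₀.map (F₀ → F)`. Then for every `η₀`, `P₀`: `⟨[η₀], P₀⟩_{F₀} = Tr_{F₀/ℚ_p}(c₀ · exp*_{d₀}(η₀) · log_ω P₀)` with
`c₀ = [F:F₀]⁻¹ · Tr_{F/F₀}(c)`. [cite: Kato1993LNM1553, Ch. II §1.2.4 and Thm. 1.4.1 (4)] [cite: SerreLocalFields1979, XIII §3 Prop. 7]
[cite: NeukirchSchmidtWingberg2008, (7.1.4) and (7.2.6)] -/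
theorem tatePairingPoint_eq_trace_of_res
    (hinj : (bdRPeriodRingData (F := F) (p := p) hp).CupLogInjective (logCyclotomic p)
      ((restrictedRationalTateRep W F₀ p).restrict (absGaloisRestrict F₀ F)))
    (hde : ∀ z : contOneCocycles ((restrictedRationalTateRep W F₀ p).restrict (absGaloisRestrict F₀ F)).toTopRep,
      (bdRPeriodRingData (F := F) (p := p) hp).HasDualExp (logCyclotomic p)
        ((restrictedRationalTateRep W F₀ p).restrict (absGaloisRestrict F₀ F)) fun σ => z.1 σ)
    (d₀ : (bdRPeriodRingData (F := F₀) (p := p) hp₀).FilZeroLine (restrictedRationalTateRep W F₀ p))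
    (d : (bdRPeriodRingData (F := F) (p := p) hp).FilZeroLine ((restrictedRationalTateRep W F₀ p).restrict (absGaloisRestrict F₀ F)))
    (hcomp : ∀ (η₀ : contOneCocycles (restrictedTateRep W F₀ p).toTopRep)
        (η : contOneCocycles ((restrictedTateRep W F₀ p).restrict (absGaloisRestrict F₀ F)).toTopRep),
        (∀ σ, η.1 σ = η₀.1 (absGaloisRestrict F₀ F σ)) →
        expStarCoordTower W hp d η = algebraMap F₀ F (expStarCoord W hp₀ d₀ η₀))
    (hlog : ∀ P₀ : (W.baseChange F₀).toAffine.Point,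
      FormalGroupChart.padicLogPointFiniteExt w (W.baseChange F) p
          (WeierstrassCurve.Affine.Point.map (IsScalarTower.toAlgHom K₀ F₀ F) P₀) =
        algebraMap F₀ F (FormalGroupChart.padicLogPointFiniteExt w₀ (W.baseChange F₀) p P₀))
    (c : F)
    (hrecF : ∀ (η₀ : contOneCocycles (restrictedTateRep W F₀ p).toTopRep) (P₀ : (W.baseChange F₀).toAffine.Point),
      ((tatePairingPoint W F p e hμ hadd₁ hadd₂ hgal hcompat
          (oneCocycleClass _ (contOneCocycles.pullback (absGaloisRestrict F₀ F)
            ((W.tateGaloisRep p (W.continuous_galoisRepTate_holds p)).toIntRep.restrictConjHom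
              ((absGaloisRestrict K₀ F₀).comp (absGaloisRestrict F₀ F)) (absGaloisRestrict K₀ F) τ hconj) η₀))
          (WeierstrassCurve.Affine.Point.map (IsScalarTower.toAlgHom K₀ F₀ F) P₀) : ℤ_[p]) : ℚ_[p]) =
        Algebra.trace ℚ_[p] F
          (c * expStarCoord W hp (d.map gV (ratGalEquiv_intertwines W F₀ hconj hgVdef))
            (contOneCocycles.pullback (absGaloisRestrict F₀ F)
              ((W.tateGaloisRep p (W.continuous_galoisRepTate_holds p)).toIntRep.restrictConjHom
                ((absGaloisRestrict K₀ F₀).comp (absGaloisRestrict F₀ F)) (absGaloisRestrict K₀ F) τ hconj) η₀) *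
            FormalGroupChart.padicLogPointFiniteExt w (W.baseChange F) p
              (WeierstrassCurve.Affine.Point.map (IsScalarTower.toAlgHom K₀ F₀ F) P₀)))
    (η₀ : contOneCocycles (restrictedTateRep W F₀ p).toTopRep) (P₀ : (W.baseChange F₀).toAffine.Point) :
    ((tatePairingPoint W F₀ p e hμ hadd₁ hadd₂ hgal hcompat (oneCocycleClass _ η₀) P₀ : ℤ_[p]) : ℚ_[p]) =
      Algebra.trace ℚ_[p] F₀
        (((Module.finrank F₀ F : F₀)⁻¹ * Algebra.trace F₀ F c) * expStarCoord W hp₀ d₀ η₀ *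
          FormalGroupChart.padicLogPointFiniteExt w₀ (W.baseChange F₀) p P₀) := by
  -- the degree formula for the pairing, at the class of `η₀`
  have hdeg := tatePairingPoint_res W F₀ F p e hμ hadd₁ hadd₂ hgal hcompat hτ hconj (oneCocycleClass _ η₀) P₀
    (WeierstrassCurve.Affine.Point.map (IsScalarTower.toAlgHom K₀ F₀ F) P₀)
    (baseChangeGeomPointsEquiv_toGeomPoints_map W F₀ F P₀)
  rw [map_oneCocycleClass] at hdeg
  -- Kato's formula over `F` at `(Res η₀, P₀)` read through `exp*`/`log` functoriality and the transitivity of the trace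
  have hF := hrecF η₀ P₀
  rw [hdeg, expStarCoord_map_res_eq_algebraMap W F₀ hp hconj hgVdef hp₀ hinj hde d₀ d hcomp η₀, hlog, mul_assoc, ← map_mul,
    show c * algebraMap F₀ F (expStarCoord W hp₀ d₀ η₀ * FormalGroupChart.padicLogPointFiniteExt w₀ (W.baseChange F₀) p P₀) =
      (expStarCoord W hp₀ d₀ η₀ * FormalGroupChart.padicLogPointFiniteExt w₀ (W.baseChange F₀) p P₀) • c from by
        rw [Algebra.smul_def, mul_comm],
    ← Algebra.trace_trace (S := F₀), LinearMap.map_smul, smul_eq_mul] at hF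
  -- `hF : ↑([F:F₀] * ⟨η₀, P₀⟩) = Tr_{F₀/ℚ_p}((exp* · log) * Tr_{F/F₀} c)`; divide by the degree
  have hn : (Module.finrank F₀ F : ℚ_[p]) ≠ 0 := Nat.cast_ne_zero.mpr Module.finrank_pos.ne'
  have hn₀ : (Module.finrank F₀ F : F₀) ≠ 0 := Nat.cast_ne_zero.mpr Module.finrank_pos.ne'
  rw [PadicInt.coe_mul, PadicInt.coe_natCast] at hF
  have key : ((tatePairingPoint W F₀ p e hμ hadd₁ hadd₂ hgal hcompat (oneCocycleClass _ η₀) P₀ : ℤ_[p]) : ℚ_[p]) =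
      (Module.finrank F₀ F : ℚ_[p])⁻¹ * Algebra.trace ℚ_[p] F₀
        ((expStarCoord W hp₀ d₀ η₀ * FormalGroupChart.padicLogPointFiniteExt w₀ (W.baseChange F₀) p P₀) * Algebra.trace F₀ F c) := by
    rw [← hF, ← mul_assoc, inv_mul_cancel₀ hn, one_mul]
  have hsm : ((Module.finrank F₀ F : F₀)⁻¹ * Algebra.trace F₀ F c) * expStarCoord W hp₀ d₀ η₀ *
        FormalGroupChart.padicLogPointFiniteExt w₀ (W.baseChange F₀) p P₀ =
      ((Module.finrank F₀ F : ℚ_[p])⁻¹) •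
        ((expStarCoord W hp₀ d₀ η₀ * FormalGroupChart.padicLogPointFiniteExt w₀ (W.baseChange F₀) p P₀) * Algebra.trace F₀ F c) := by
    rw [Algebra.smul_def, map_inv₀, map_natCast]; ring
  rw [key, hsm, LinearMap.map_smul, smul_eq_mul]

/-! ### The degree formula at `P := P₀.map (F₀ → F)` (no coordinate hypothesis) -/

omit [Fact (¬ IsUnit (p : integerC F₀))] [IsAdicComplete (Ideal.span {(p : integerC F₀)}) (integerC F₀)]
  [Algebra ℚ_[p] F₀] [FiniteDimensional ℚ_[p] F₀] [Fact (¬ IsUnit (p : integerC F))]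
  [IsAdicComplete (Ideal.span {(p : integerC F)}) (integerC F)] [Algebra ℚ_[p] F] [IsScalarTower ℚ_[p] F₀ F] in
include hτ in
/-- ★ **The degree formula at the base-changed point**: `⟨Res x₀, P₀.map (F₀ → F)⟩_F = [F : F₀] · ⟨x₀, P₀⟩_{F₀}` — `tatePairingPoint_res`
(`LocalTatePairingRestriction`) with its coordinate hypothesis `hP` discharged by `baseChangeGeomPointsEquiv_toGeomPoints_map`
(`LocalPointsBaseChangeTower`). [cite: SerreLocalFields1979, XIII §3 Prop. 7] [cite: NeukirchSchmidtWingberg2008, (7.1.4) and (7.2.6)] -/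
theorem tatePairingPoint_res_map
    (x₀ : continuousCohomology 1 (restrictedTateRep W F₀ p).toTopRep) (P₀ : (W.baseChange F₀).toAffine.Point) :
    tatePairingPoint W F p e hμ hadd₁ hadd₂ hgal hcompat
        (ContinuousCohomology.map (absGaloisRestrict F₀ F)
          ((W.tateGaloisRep p (W.continuous_galoisRepTate_holds p)).toIntRep.restrictConjHom
            ((absGaloisRestrict K₀ F₀).comp (absGaloisRestrict F₀ F)) (absGaloisRestrict K₀ F) τ hconj) 1 x₀)
        (WeierstrassCurve.Affine.Point.map (IsScalarTower.toAlgHom K₀ F₀ F) P₀) =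
      (Module.finrank F₀ F : ℤ_[p]) * tatePairingPoint W F₀ p e hμ hadd₁ hadd₂ hgal hcompat x₀ P₀ :=
  tatePairingPoint_res W F₀ F p e hμ hadd₁ hadd₂ hgal hcompat hτ hconj x₀ P₀ _
    (baseChangeGeomPointsEquiv_toGeomPoints_map W F₀ F P₀)

/-! ### The `log_ω` hypothesis `hlog` for an isometric tower -/

omit [CharZero K₀] [Fact (¬ IsUnit (p : integerC F₀))] [IsAdicComplete (Ideal.span {(p : integerC F₀)}) (integerC F₀)]
  [Algebra ℚ_[p] F₀] [FiniteDimensional ℚ_[p] F₀] [Fact (¬ IsUnit (p : integerC F))]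
  [IsAdicComplete (Ideal.span {(p : integerC F)}) (integerC F)] [Algebra ℚ_[p] F] [IsScalarTower ℚ_[p] F₀ F] [FiniteDimensional F₀ F] in
include hp₀ hp in
/-- **`log_ω` commutes with the extension `F/F₀`** when `w` extends `w₀` (`w (algebraMap x) = w₀ x`): for every `P₀ ∈ E(F₀)`,
`log_ω^F(P₀.map (F₀ → F)) = algebraMap F₀ F (log_ω^{F₀} P₀)` — the hypothesis `hlog` of `tatePairingPoint_eq_trace_of_res`, from the tree's
`padicLogPointFiniteExt_map_of_val_eq` with (SPEC) and the level-multiples supplied by `limitLog_spec_of_isNonarchimedeanLocalField` /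
`exists_nsmul_mem_level_of_isNonarchimedeanLocalField` at both fields. [cite: SilvermanAEC2009, Thm. IV.6.4 with Prop. VII.2.2] -/
theorem padicLogPointFiniteExt_map_toAlgHom [w₀.Compatible] [w.Compatible] (hw₀ : w₀ (p : F₀) < 1)
    (hiso : ∀ x : F₀, w (algebraMap F₀ F x) = w₀ x)
    (P₀ : (W.baseChange F₀).toAffine.Point) :
    FormalGroupChart.padicLogPointFiniteExt w (W.baseChange F) p
        (WeierstrassCurve.Affine.Point.map (IsScalarTower.toAlgHom K₀ F₀ F) P₀) =
      algebraMap F₀ F (FormalGroupChart.padicLogPointFiniteExt w₀ (W.baseChange F₀) p P₀) := by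
  have hp₀0 : (p : F₀) ≠ 0 := Nat.cast_ne_zero.mpr (Fact.out : p.Prime).ne_zero
  have hp0 : (p : F) ≠ 0 := Nat.cast_ne_zero.mpr (Fact.out : p.Prime).ne_zero
  obtain ⟨m, hm, hmP⟩ := FormalGroupChart.exists_nsmul_mem_level_of_isNonarchimedeanLocalField (W.baseChange F₀) w₀ hp₀0 P₀
  exact FormalGroupChart.padicLogPointFiniteExt_map_of_val_eq (X := W) hp₀0 hw₀
    (FormalGroupChart.limitLog_spec_of_isNonarchimedeanLocalField (W.baseChange F₀) w₀ hp₀0 hp₀)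
    (FormalGroupChart.limitLog_spec_of_isNonarchimedeanLocalField (W.baseChange F) w hp0 hp)
    (ι := IsScalarTower.toAlgHom K₀ F₀ F) (fun x => hiso x) hm hmP

end Literature.NumberTheory.EllipticCurves

end
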